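import Summits.BirchSwinnertonDyer.BirchSwinnertonDyer.Theorems.CountingDoorF2AtThreeLambdaKernel
import Literature.NumberTheory.EllipticCurves.CanonicalPAdicHeightIntegralityProofs
import Literature.NumberTheory.EllipticCurves.BSDSelmerPConverseSerreProofs
import Literature.NumberTheory.EllipticCurves.SemistableModPImageFiveProofs
import HarnessLib

/-!
# BirchSwinnertonDyer / CountingDoorF2AtThree — the λ-door per member with the height integrality
# DISCHARGED (companion of `CountingDoorF2AtThreeLambdaKernel.lean`; helper for crux I4,
# stmt-BirchSwinnertonDyer-19442, and for the sibling λ-door at a non-anomalous prime `p ≥ 5`)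

`CountingDoorF2AtThreeLambdaKernel.lean` (D)/(E) carry the integrality of the canonical `p`-adic
height as the hypothesis `‖Reg_p(E, Dh)‖ ≤ p^{-rank}`. Seat lit GEN 11 has since PROVED Mazur–Tate's
integrality in the tree (`WeierstrassCurve.norm_pairing_le_of_not_anomalous`, p444012: `⟨P,Q⟩_Dh ∈ pℤ_p`
for the canonical datum at a good ordinary `p ≥ 3` with `a_p ≢ 1 (mod p)`, provided `p` divides no index
`[E(ℚ) : E(ℚ) ∩ Ẽ_ns(ℓ)-locus]`; those indices are `1` at the good primes, p445328) together with
`WeierstrassCurve.norm_padicRegulator_le_of_forall_norm_pairing_le`. This file composes: the door's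
hypotheses are now the two named facts (`Schneider1985_order_charGenerator_odd`, `kato_divisibility`),
congruence / semistability / index conditions on the member, `r ≤ rank`, and the single analytic input
`‖[T^r] L_p(f, α)‖ = 1` — exactly the regime tabulated in `HOME/bsd-rank2-eng/data/f2door/LAMBDA5.md`
(door fires on 409/409 + 388/388 such members of `F₂` at `p = 5, 7`). PARTITION: none — r_an ≥ 2,
summit axis S0; TWIN (D-0056): n/a. B1 honesty: per-member kernel modulo published named facts;
nothing family-wise; no analytic rank is mentioned.
-/

set_option linter.dupNamespace false

noncomputable section

namespace Summit.BirchSwinnertonDyer.BirchSwinnertonDyer.Theorems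

open Literature.NumberTheory.EllipticCurves WeierstrassCurve

variable {W : WeierstrassCurve ℚ} [W.IsElliptic] [W.IsGloballyMinimal] {p : ℕ} [hp : Fact p.Prime]

/-- **(E′) The λ-door at `p ≥ 5` with the height integrality DISCHARGED** (the cell's final
per-member form): as (E), but the regulator bound `‖Reg_p‖ ≤ p^{-rank}` is no longer a hypothesis —
it follows from Mazur–Tate's integrality of the canonical pairing, PROVED in the tree by seat lit GEN 11
(`WeierstrassCurve.norm_pairing_le_of_not_anomalous`: `⟨P,Q⟩ ∈ pℤ_p` when `a_p ≢ 1 (mod p)` and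
`p ∤ [E(ℚ) : E(ℚ) ∩ Ẽ_ns-locus at ℓ]` for every prime `ℓ`, p444012; the index is `1` at every good `ℓ`,
p445328, so `hidx` concerns the finitely many bad primes; and
`WeierstrassCurve.norm_padicRegulator_le_of_forall_norm_pairing_le`). Remaining hypotheses: the two
named facts (`Schneider1985_order_charGenerator_odd`, `kato_divisibility W p`), good ordinary
non-anomalous `p ≥ 5`, semistable, `E[p]` irreducible, `p ∤ #E(ℚ)_tors`, the index condition at the
bad primes, `r ≤ rank`, and the ONE analytic input `‖[T^r] L_p(f, α)‖ = 1`.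
[cite: MazurTate1983Biext, §3.3] [cite: Kato2004Asterisque, Thm. 17.4 (p. 273)]
[cite: BalakrishnanMullerStein2015, Thm. 1.7] [cite: Serre1972, §5.4 Prop. 21 i)] -/
theorem lambdaDoor_of_norm_coeff_padicLFunction_of_index
    (h85 : Schneider1985_order_charGenerator_odd)
    (hp5 : 5 ≤ p) (hgood : W.HasGoodReductionAtPrime p) (hord : ¬ (p : ℤ) ∣ W.frobeniusTrace p)
    {κ : ZpExtension ℚ p} {γ : Field.absoluteGaloisGroup ℚ}
    (hκ : κ.IsCyclotomic) (hγ : κ.IsTopGenerator γ) (hγ' : IsCyclotomicVariable p γ)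
    {N : ℕ} [NeZero N] {f : CuspForm (CongruenceSubgroup.Gamma0 N) 2}
    (hfN : ModularForms.IsNewformOf W f) (hK : kato_divisibility W p (κ := κ) (γ := γ) (f := f))
    (hsemi : W.IsSemistable (NumberField.RingOfIntegers ℚ)) (hirr : W.HasIrreducibleModPGaloisRep p)
    (D : W.SelmerDualData κ γ) [Module.Finite (IwasawaAlgebra p) D.X]
    {fE : IwasawaAlgebra p} (hf : D.charIdeal = Ideal.span {fE})
    {r : ℕ} (hr : r ≤ W.mordellWeilRank)
    (hL : ‖PowerSeries.coeff r (padicLFunction f (unitRoot W p : ℚ_[p]))‖ = 1)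
    (Dh : PAdicHeightData W p) (hDh : Dh.IsCanonical)
    (hna : ¬ p ∣ W.reductionPointCount p) (htors : ¬ p ∣ W.torsionOrder)
    (hidx : ∀ (ℓ : ℕ) [Fact ℓ.Prime], ¬ p ∣ (W.nonsingularReductionSubgroupAt ℓ).index) :
    W.mordellWeilRank = r ∧ fE.order = r ∧
      (padicLFunction f (unitRoot W p : ℚ_[p])).order = r ∧ SchneiderConjecture Dh ∧
      AddCommGroup.primaryComponent W.sha p = ⊥ ∧ ¬ p ∣ W.tamagawaProduct ∧
      ‖padicRegulator Dh‖ = ((p : ℝ)⁻¹) ^ r ∧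
      ∃ h : IwasawaAlgebra p, IsUnit h ∧
        iwasawaToPowerSeries p (h * fE) = padicLFunction f (unitRoot W p : ℚ_[p]) := by
  -- `p ∤ #Ẽ(𝔽_p)` ⟺ `a_p ≢ 1 (mod p)` since `a_p = p + 1 - #Ẽ(𝔽_p)`
  have hna' : ¬ (p : ℤ) ∣ W.frobeniusTrace p - 1 := by
    rintro ⟨k, hk⟩
    apply hna
    rw [WeierstrassCurve.frobeniusTrace] at hk
    exact Int.natCast_dvd_natCast.mp ⟨1 - k, by linarith [hk]⟩
  have hint : ‖padicRegulator Dh‖ ≤ ((p : ℝ)⁻¹) ^ W.mordellWeilRank :=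
    WeierstrassCurve.norm_padicRegulator_le_of_forall_norm_pairing_le W p
      (WeierstrassCurve.norm_pairing_le_of_not_anomalous W p (by omega) hgood hna' hidx hDh)
  have hp2 : p ≠ 2 := by omega
  have hsurj : ∀ n : ℕ, W.HasSurjectiveModNGaloisRep (p ^ n : ℕ) :=
    serre_hasSurjectiveModNGaloisRep_pow_holds W p hp5
      (hasSurjectiveModNGaloisRep_of_hasIrreducibleModPGaloisRep_of_isSemistable W hsemi p hirr)
  exact lambdaDoor_of_norm_coeff_padicLFunction h85 hp2 hgood hord hκ hγ hγ' hfN hK hsurj D hf hr hL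
    Dh hDh hna htors hint

end Summit.BirchSwinnertonDyer.BirchSwinnertonDyer.Theorems

end
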